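import Mathlib
import Literature.MathematicalPhysics.QuantumManyBody.BoseEinsteinCondensation
import Literature.MathematicalPhysics.QuantumManyBody.PeriodicBoseGas
import Literature.MathematicalPhysics.QuantumManyBody.HardCoreScatteringLength

/-!
# Sketch — crux-ideate stmt-AtomisticToContinuum-11786 (HardCoreExtension), round 1, ideator 1

First-lemma signatures for the two crux idea cards
`shielded-insertion-peeling` and `domination-order-reversal`.
Nothing here is proved; every `def … : Prop` must elaborate (rc 0).
-/

noncomputable section

open Filter
open scoped ENNReal NNReal

namespace Summit.AtomisticToContinuum.BoseEinsteinCondensation.Cruxes.HardCoreExtension.Sketch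

open Literature.MathematicalPhysics.QuantumManyBody.BoseGas

/-- The smooth class of the route (antecedent of `HardCoreExtension`), bundled. -/
def IsSmoothClass (v : ℝ → ℝ≥0∞) : Prop :=
  IsRepulsiveFiniteRange v ∧ (∀ r, v r ≠ ⊤) ∧
    ContDiff ℝ 2 (fun x : Space => (v ‖x‖).toReal) ∧
    ∃ Cₑ : ℝ, ∀ x : Space,
      ‖iteratedFDeriv ℝ 2 (fun x : Space => (v ‖x‖).toReal) x‖ ≤ Cₑ * Real.sqrt ((v ‖x‖).toReal)

/-- Hard core (hard sphere) of radius `a` = the TREE's `hardCorePotential a` (`⊤` on `r < a`,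
`0` otherwise; `scatteringLength_hardCorePotential : a(HS_a) = ofReal a`). -/
abbrev hardCore (a : ℝ) : ℝ → ℝ≥0∞ := hardCorePotential a

/-- Sanity (tree facts): the hard core is admissible and has scattering length `a`. -/
example (a : ℝ) : IsRepulsiveFiniteRange (hardCore a) ∧ scatteringLength (hardCore a) = ENNReal.ofReal a :=
  ⟨isRepulsiveFiniteRange_hardCorePotential a, scatteringLength_hardCorePotential a⟩

/-- Dilute ground-state BEC for a potential (the shape of both sides of the crux). -/
def DiluteBEC (v : ℝ → ℝ≥0∞) : Prop :=
  ∃ ρ₀ : ℝ, 0 < ρ₀ ∧ ∀ ρ : ℝ, 0 < ρ → ρ < ρ₀ → HasGroundStateBEC v ρ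

/-- The crux's antecedent `A` (verbatim content, bundled). -/
def SmoothClassBEC : Prop :=
  ∀ v : ℝ → ℝ≥0∞, IsSmoothClass v → DiluteBEC v

/-- Uniform-FRACTION reading of the antecedent (planner repair option B2 of NOTES.md): one
fraction `c₀` for the whole smooth class, thresholds `ρ₀(w)`, `N₀(w,ρ)` still non-uniform.
The route's IMUChainGlue delivers `c₀ = 1/4` on the torus. -/
def UniformFractionSmoothBEC (c₀ : ℝ) : Prop :=
  ∀ w : ℝ → ℝ≥0∞, IsSmoothClass w → ∃ ρ₀ : ℝ, 0 < ρ₀ ∧ ∀ ρ : ℝ, 0 < ρ → ρ < ρ₀ →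
    ∀ᶠ N : ℕ in atTop, ENNReal.ofReal (c₀ * N) ≤ condensateNumber w N (sideLength ρ N)

/-! ## Card `domination-order-reversal` -/

/-- DOMINATION ORDER REVERSAL (repulsion-monotonicity with `o(N)` slack, smooth bounded
dominant): if `v ≤ w` pointwise with `w` in the smooth class, then along the thermodynamic
sequence at every small density the condensate number of `w` exceeds that of `v` by at most
`εN`, eventually, for every `ε > 0`. First checkable statement of the card. -/
def DominationOrderReversal : Prop :=
  ∀ v w : ℝ → ℝ≥0∞, IsRepulsiveFiniteRange v → IsSmoothClass w → (∀ r, 0 ≤ r → v r ≤ w r) →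
    ∃ ρ₁ : ℝ, 0 < ρ₁ ∧ ∀ ρ : ℝ, 0 < ρ → ρ < ρ₁ → ∀ ε : ℝ, 0 < ε →
      ∀ᶠ N : ℕ in atTop,
        condensateNumber w N (sideLength ρ N) ≤
          condensateNumber v N (sideLength ρ N) + ENNReal.ofReal (ε * N)

/-- Every BOUNDED admissible potential lies below a smooth-class potential (support). -/
def SmoothDominant : Prop :=
  ∀ v : ℝ → ℝ≥0∞, IsRepulsiveFiniteRange v → (∃ M : ℝ≥0, ∀ r, v r ≤ M) →
    ∃ w : ℝ → ℝ≥0∞, IsSmoothClass w ∧ ∀ r, 0 ≤ r → v r ≤ w r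

/-- The bounded half of the crux: smooth-class BEC implies dilute BEC for every BOUNDED
repulsive finite-range potential (kinks, steps, finite shells, C² without the edge condition). -/
def HardCoreExtensionBounded : Prop :=
  SmoothClassBEC →
    ∀ v : ℝ → ℝ≥0∞, IsRepulsiveFiniteRange v → (∃ M : ℝ≥0, ∀ r, v r ≤ M) → DiluteBEC v

/-- Card claim (logic + ENNReal arithmetic, to be proved by the lead):
domination + dominant existence settle the bounded half with the antecedent used ONCE. -/
def bounded_half_of_domination : Prop :=
  DominationOrderReversal → SmoothDominant → HardCoreExtensionBounded

/-- Scattering-length calibration of the same lever (stronger, conjectural): a smooth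
potential with at least twice the scattering length condenses no better, eventually. With it the
WHOLE crux follows from the antecedent applied to one shield. -/
def ScatteringOrderReversal : Prop :=
  ∀ v w : ℝ → ℝ≥0∞, IsRepulsiveFiniteRange v → IsSmoothClass w →
    2 * scatteringLength v ≤ scatteringLength w → 0 < scatteringLength v →
    ∃ ρ₁ : ℝ, 0 < ρ₁ ∧ ∀ ρ : ℝ, 0 < ρ → ρ < ρ₁ → ∀ ε : ℝ, 0 < ε →
      ∀ᶠ N : ℕ in atTop,
        condensateNumber w N (sideLength ρ N) ≤
          condensateNumber v N (sideLength ρ N) + ENNReal.ofReal (ε * N)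

/-! ## Card `shielded-insertion-peeling` -/

/-- PEELING MONOTONICITY (leg 2): removing a bounded repulsive layer `u` supported OUTSIDE the
core `[0,a]` from `hardCore a + u` costs at most `o(N)` condensate, eventually, at small density.
(Instance of repulsion-monotonicity in which the hard core is common to both sides.) -/
def PeelingMonotone : Prop :=
  ∀ a : ℝ, 0 < a → ∀ u : ℝ → ℝ≥0∞, IsRepulsiveFiniteRange u → (∃ M : ℝ≥0, ∀ r, u r ≤ M) →
    (∀ r, r < a → u r = 0) →
    ∃ ρ₁ : ℝ, 0 < ρ₁ ∧ ∀ ρ : ℝ, 0 < ρ → ρ < ρ₁ → ∀ ε : ℝ, 0 < ε →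
      ∀ᶠ N : ℕ in atTop,
        condensateNumber (fun r => hardCore a r + u r) N (sideLength ρ N) ≤
          condensateNumber (hardCore a) N (sideLength ρ N) + ENNReal.ofReal (ε * N)

/-- SHIELDED INSERTION (leg 1, additive form): inserting the hard core of radius `a` UNDER a
smooth-class shield `W` that is at least `h` on `[0,σ]`, `σ > a`, changes the condensate number
by at most `θN` eventually, with `θ → 0` as the shield height `h → ∞` (at fixed `a, σ`, uniformly
in small `ρ`). Mechanism on the card: Duhamel along the class ray `W + tU`,
`|Δñ₀| ≤ 2 · sup_t √Var(ñ₀) · (Fubini–Study length)`, length `≲ √N · (a(W+HS_a) − a(W))`. -/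
def ShieldedInsertion : Prop :=
  ∀ a σ : ℝ, 0 < a → a < σ → ∀ θ : ℝ, 0 < θ → ∃ h : ℝ≥0, ∀ W : ℝ → ℝ≥0∞, IsSmoothClass W →
    (∀ r, 0 ≤ r → r ≤ σ → (h : ℝ≥0∞) ≤ W r) →
    ∃ ρ₁ : ℝ, 0 < ρ₁ ∧ ∀ ρ : ℝ, 0 < ρ → ρ < ρ₁ →
      ∀ᶠ N : ℕ in atTop,
        condensateNumber W N (sideLength ρ N) ≤
          condensateNumber (fun r => W r + hardCore a r) N (sideLength ρ N) + ENNReal.ofReal (θ * N)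

/-- Tall smooth-class shields exist at every height and radius (support; e.g. `h·(σ'²−r²)₊⁴`
rescaled, `σ < σ'`). -/
def ShieldExists : Prop :=
  ∀ σ : ℝ, 0 < σ → ∀ h : ℝ≥0, ∃ W : ℝ → ℝ≥0∞, IsSmoothClass W ∧ (∀ r, 0 ≤ r → r ≤ σ → (h : ℝ≥0∞) ≤ W r) ∧
    (∀ r, 2 * σ < r → W r = 0) ∧ ∃ M : ℝ≥0, ∀ r, W r ≤ M

/-- The peel composes: `hardCore a + (W off the core) = W + hardCore a` as potentials (`⊤` absorbs). -/
theorem peel_identity (a : ℝ) (W : ℝ → ℝ≥0∞) :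
    (fun r => hardCore a r + (if r < a then 0 else W r)) = fun r => W r + hardCore a r := by
  funext r
  by_cases h : r < a
  · simp [hardCore, hardCorePotential, h]
  · simp [hardCore, hardCorePotential, h]

/-- Hard-sphere BEC (the residue of the crux that no domination from above can reach). -/
def HardSphereBEC : Prop :=
  ∀ a : ℝ, 0 < a → DiluteBEC (hardCore a)

/-- Card claim (composition, to be proved by the lead): under the uniform-fraction reading of
the antecedent, the two legs give hard-sphere BEC: for `W` a shield of height `h(θ)` with
`θ < c₀/2`, eventually `c₀N ≤ cn(W) ≤ cn(W + HS_a) + θN ≤ cn(HS_a) + θN + εN`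
(the layer `W|_{(a,2σ]}` is peeled by `PeelingMonotone`). -/
def hardSphere_of_shield : Prop :=
  PeelingMonotone → ShieldedInsertion → ShieldExists →
    ∀ c₀ : ℝ, 0 < c₀ → UniformFractionSmoothBEC c₀ → HardSphereBEC

end Summit.AtomisticToContinuum.BoseEinsteinCondensation.Cruxes.HardCoreExtension.Sketch

end
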